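import Summits.CriticalPhenomena.CardyFormulaZ2.Theses.CardyNeumannHarmonic

/-!
# `EvenReflectionLaw` — birth skeleton (BC3), crux `stmt-CriticalPhenomena-18934`
of `route-CriticalPhenomena-CardyNeumannHarmonic` (sub-problem `CardyFormulaZ2`), line `birth`.

Crux (FIXED — the route's decl, not restated; concluded BY NAME by `EvenReflectionLaw_of`):
`Summit.CriticalPhenomena.CardyFormulaZ2.Theses.CardyNeumannHarmonic.EvenReflectionLaw` — for every
3-marked Jordan domain `T`, mesh sequence `u → 0⁺`, continuous locally uniform limit `G` of the
bond-`ℤ²` separating triple, corner `α` and mark-free ball `B(ζ,r)` in which the carrier is the open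
half-ball on the side of an axis-parallel unit normal `n` (a flat piece of the arc opposite corner
`α`), the difference `W = G (α+1) − G (α+2)` pairs to zero against `Δφ` for every non-negative `C²`
test `φ` supported in the ball and EVEN under the reflection across the flat line:
`∫_{T.carrier} W Δφ = 0` (weak form of: `W` is harmonic up to the piece with homogeneous Neumann
data / its even reflection is harmonic on the ball).

## The line (`birth`): the two Euler–Lagrange halves of the weak Neumann problem + a layer lemma

By Green's identity with `∂ₙφ = 0` on the flat line (φ even), the crux is exactly
"`ΔW = 0` in the half-ball AND `∂ₙW = 0` on the piece". The skeleton cuts it along that seam, with the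
boundary condition typed WITHOUT derivatives of the merely continuous `W`, as an `o(y)` law for its
NORMAL INCREMENTS in the layer `y … 2y` above the piece (the form the route's lattice mechanism —
duality sum rule + lattice reflection across the normal line + boundary two-arm germ decoupling —
produces, route header "TWO-LAYER PLAN"):

* `stub_layerHarmonicity` (interior half, "rank-2 type"): under the crux's hypotheses, `W` is weakly
  harmonic in the open half-ball `T.carrier ∩ B(ζ,r)`: `∫_{T.carrier} W Δφ = 0` for every `C²` test `φ`
  compactly supported INSIDE the open half-ball (no evenness, no sign). Strictly weaker than the crux
  (even symmetrisation of an interior test is an admissible even test whose mirror half misses the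
  carrier), and on its own it does not give the crux (`W(x,y) = y` on the upper half-disc is harmonic
  with `∂ₙW ≠ 0`). Summit-type difficulty (harmonicity of a difference of two separating
  probabilities; in axis-stretched fake-Cardy worlds it fails while the Neumann half survives —
  refuter note on the item, 2026-08-17).
* `stub_normalIncrementGerm` (boundary half = the route's NEW lever, "NormalIncrementGerm" at the
  level of subsequential limits): for every compact piece `K` of the flat line inside the ball and
  every `ε > 0` there is `y₀ > 0` with `|W(x + 2y·n) − W(x + y·n)| ≤ ε·y` for all `x ∈ K`,
  `0 < y < y₀` — the normal increments of `W` across the layer are `o(y)` uniformly along compact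
  pieces. Mechanism (route header WHY THIS LINE): near a flat boundary point both normal increments of
  `H_(α+1)` and `H_(α+2)` equal `−K·ρ·y + o(y)` with the SAME boundary two-arm germ constant (the
  lattice reflection across the normal line swaps the two hull pictures) and the same tangential
  landing density (duality sum rule `G_(α+1) + G_(α+2) = 1` on the arc), uniformly in the mesh, so the
  difference is `o(y)`; locally uniform convergence on the carrier passes it to `G`. It does not give
  the crux alone (`W(x,y) = y²` satisfies it and is not harmonic). Why it might fail: boundary
  two-arm germ decoupling uniform along the piece (pockets / multiple touchings at scale `o(y)`) is
  unwritten on `ℤ²`. In the Cardy world `W = (2/√3)·Im(s^{-α}Φ)` is real-analytic up to the open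
  piece (Schwarz reflection) with `∂ₙW = 0`, so the increments are `O(y²)`.
* `stub_incrementsToReflection` (pure analysis, size M; no percolation): for ANY open `U ⊆ ℂ` whose
  trace on `B(ζ,r)` is the open half-ball, any `W` continuous on `U`, weakly harmonic in
  `U ∩ B(ζ,r)` and with `o(y)` normal increments uniformly on compact pieces of the flat line, the
  even pairing vanishes: `∫_U W Δφ = 0` for every even non-negative `C²` test supported in the ball.
  Proof plan: Weyl ⇒ `W` harmonic in the half-ball; the increment law telescoped dyadically gives
  boundedness of `W` in layers over compact pieces; Green on `{Re((z−ζ)n̄) > ε}`: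
  `∫ W Δφ = lim_ε ∫ (−W ∂ₙφ + φ ∂ₙW)(· + εn)`; `∂ₙφ(·+εn) = O(ε)` by evenness; for a `C²` tangential
  test `ψ`, `g_ψ(y) = ∫ ψ ∂ₙW(·+yn)` is Lipschitz in `y` (`g_ψ' = −∫ ψ'' W`, `W` bounded) and has
  means `y⁻¹∫_y^{2y} g_ψ = y⁻¹∫ψ (W(·+2yn) − W(·+yn)) → 0` by the increment law, hence `g_ψ(y) → 0`;
  the correction `φ(·+εn) − φ(·)` is `O(ε²)` in sup norm with `o(1)` second tangential derivative.

`EvenReflectionLaw_of` composes them WITHOUT `sorry`: apply the layer lemma to `U = T.carrier`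
(open: `T.isOpen`), `W = G (α+1) − G (α+2)` (continuous on the carrier: hypotheses of the crux), the
two percolation stubs supplying its two analytic inputs.

Disproof used: none on file — `ledger crux ls stmt-CriticalPhenomena-18934` lists no workfiles
(no `Disproof.lean`, no `Lines/*`, no `Theorems/EvenReflectionLaw/Negative/*`) at registration
(2026-08-17); the refuter's crux-attack (item note 2026-08-17T06:50:53Z, kit j022895) found no
first-order violation of the lattice Neumann law (Q → 0 like 1/L at L = 32/64/128), consistent with
`stub_normalIncrementGerm`.
-/

noncomputable section

namespace Summit.CriticalPhenomena.CardyFormulaZ2.Cruxes.EvenReflectionLaw.Birth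

open MeasureTheory Filter Topology
open Literature.Probability.Percolation Literature.Probability.RandomPlanarGeometry
open Summit.CriticalPhenomena.CardyFormulaZ2.Theses.CardyNeumannHarmonic

/-! ### Stub signatures (named `Prop`s, so that `EvenReflectionLaw_of` takes its hypotheses BY NAME) -/

/-- Signature of `stub_layerHarmonicity` — **interior Euler–Lagrange half (layer harmonicity of the
difference).** Same hypotheses as the crux (any 3-marked Jordan domain `T`, mesh sequence `u → 0⁺`,
continuous locally uniform limit `G` of the bond-`ℤ²` separating triple on the carrier, corner `α`,
mark-free ball `B(ζ,r)` meeting the carrier in the open half-ball on the side of the axis-parallel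
unit normal `n`, its frontier inside the arc opposite corner `α`); conclusion: `W = G (α+1) − G (α+2)`
is WEAKLY HARMONIC in the open half-ball — `∫_{T.carrier} W Δφ = 0` for every `C²` test `φ`
compactly supported inside `T.carrier ∩ B(ζ,r)` (no evenness, no sign condition). -/
def Sig.stub_layerHarmonicity : Prop :=
  ∀ (T : Literature.Probability.RandomPlanarGeometry.MarkedDomain 3) (u : ℕ → ℝ) (G : Fin 3 → ℂ → ℝ),
    (∀ n, 0 < u n) → Filter.Tendsto u Filter.atTop (nhds 0) →
    (∀ α : Fin 3, TendstoLocallyUniformlyOn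
      (fun (n : ℕ) (z : ℂ) => Literature.Probability.Percolation.bondSeparatingProb T α (u n) z)
      (G α) Filter.atTop T.carrier) →
    (∀ α : Fin 3, ContinuousOn (G α) T.carrier) →
    ∀ (α : Fin 3) (ζ n : ℂ) (r : ℝ), (n = 1 ∨ n = -1 ∨ n = Complex.I ∨ n = -Complex.I) → 0 < r →
    T.carrier ∩ Metric.ball ζ r = {z | z ∈ Metric.ball ζ r ∧ 0 < ((z - ζ) * (starRingEnd ℂ) n).re} →
    Metric.ball ζ r ∩ frontier T.carrier ⊆ T.arc (α + 1) →
    (∀ i : Fin 3, T.pt i ∉ Metric.ball ζ r) →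
    ∀ (φ : ℂ → ℝ), ContDiff ℝ 2 φ → HasCompactSupport φ →
      tsupport φ ⊆ T.carrier ∩ Metric.ball ζ r →
      ∫ z in T.carrier, (G (α + 1) z - G (α + 2) z) * (Laplacian.laplacian φ : ℂ → ℝ) z = 0

/-- Signature of `stub_normalIncrementGerm` — **boundary Euler–Lagrange half (the Neumann germ law,
derivative-free).** Same hypotheses as the crux; conclusion: for every compact piece `K` of the flat
line `{Re((x − ζ)·n̄) = 0}` inside the ball and every `ε > 0` there is `y₀ > 0` such that the NORMAL
INCREMENTS of `W = G (α+1) − G (α+2)` across the layer are `ε`-small relative to `y`: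
`|W(x + 2y·n) − W(x + y·n)| ≤ ε·y` for all `x ∈ K`, `0 < y < y₀` (for small `y` both points lie in
the open half-ball `T.carrier ∩ B(ζ,r)`, so no junk values of `G` are read). -/
def Sig.stub_normalIncrementGerm : Prop :=
  ∀ (T : Literature.Probability.RandomPlanarGeometry.MarkedDomain 3) (u : ℕ → ℝ) (G : Fin 3 → ℂ → ℝ),
    (∀ n, 0 < u n) → Filter.Tendsto u Filter.atTop (nhds 0) →
    (∀ α : Fin 3, TendstoLocallyUniformlyOn
      (fun (n : ℕ) (z : ℂ) => Literature.Probability.Percolation.bondSeparatingProb T α (u n) z)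
      (G α) Filter.atTop T.carrier) →
    (∀ α : Fin 3, ContinuousOn (G α) T.carrier) →
    ∀ (α : Fin 3) (ζ n : ℂ) (r : ℝ), (n = 1 ∨ n = -1 ∨ n = Complex.I ∨ n = -Complex.I) → 0 < r →
    T.carrier ∩ Metric.ball ζ r = {z | z ∈ Metric.ball ζ r ∧ 0 < ((z - ζ) * (starRingEnd ℂ) n).re} →
    Metric.ball ζ r ∩ frontier T.carrier ⊆ T.arc (α + 1) →
    (∀ i : Fin 3, T.pt i ∉ Metric.ball ζ r) →
    ∀ (K : Set ℂ), IsCompact K → K ⊆ Metric.ball ζ r →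
      (∀ x ∈ K, ((x - ζ) * (starRingEnd ℂ) n).re = 0) →
      ∀ ε : ℝ, 0 < ε → ∃ y₀ : ℝ, 0 < y₀ ∧ ∀ y ∈ Set.Ioo (0 : ℝ) y₀, ∀ x ∈ K,
        |(G (α + 1) (x + 2 * (y : ℂ) * n) - G (α + 2) (x + 2 * (y : ℂ) * n))
          - (G (α + 1) (x + (y : ℂ) * n) - G (α + 2) (x + (y : ℂ) * n))| ≤ ε * y

/-- Signature of `stub_incrementsToReflection` — **the layer lemma (pure real analysis, no
percolation).** For any open `U ⊆ ℂ` whose trace on the ball `B(ζ,r)` is the open half-ball on the side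
of the axis-parallel unit normal `n`, and any `W : ℂ → ℝ` continuous on `U` which is (i) weakly
harmonic in `U ∩ B(ζ,r)` against `C²` tests compactly supported there and (ii) has `o(y)` normal
increments uniformly on compact pieces of the flat line, the EVEN PAIRING VANISHES:
`∫_U W Δφ = 0` for every non-negative `C²` test `φ` supported in `B(ζ,r)` and even under the
reflection `z ↦ z − 2·Re((z − ζ)·n̄)·n`. (Weyl's lemma; dyadic telescoping of (ii) ⇒ `W` bounded in
layers; Green's identity on `{Re((z − ζ)·n̄) > ε}`; `∂ₙφ = O(ε)` on that line by evenness; the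
tangential pairings `y ↦ ∫ ψ ∂ₙW(· + y n)` are Lipschitz with vanishing dyadic means, hence `→ 0`.) -/
def Sig.stub_incrementsToReflection : Prop :=
  ∀ (U : Set ℂ) (W : ℂ → ℝ) (ζ n : ℂ) (r : ℝ), IsOpen U →
    (n = 1 ∨ n = -1 ∨ n = Complex.I ∨ n = -Complex.I) → 0 < r →
    U ∩ Metric.ball ζ r = {z | z ∈ Metric.ball ζ r ∧ 0 < ((z - ζ) * (starRingEnd ℂ) n).re} →
    ContinuousOn W U →
    (∀ (φ : ℂ → ℝ), ContDiff ℝ 2 φ → HasCompactSupport φ → tsupport φ ⊆ U ∩ Metric.ball ζ r →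
      ∫ z in U, W z * (Laplacian.laplacian φ : ℂ → ℝ) z = 0) →
    (∀ (K : Set ℂ), IsCompact K → K ⊆ Metric.ball ζ r →
      (∀ x ∈ K, ((x - ζ) * (starRingEnd ℂ) n).re = 0) →
      ∀ ε : ℝ, 0 < ε → ∃ y₀ : ℝ, 0 < y₀ ∧ ∀ y ∈ Set.Ioo (0 : ℝ) y₀, ∀ x ∈ K,
        |W (x + 2 * (y : ℂ) * n) - W (x + (y : ℂ) * n)| ≤ ε * y) →
    ∀ (φ : ℂ → ℝ), ContDiff ℝ 2 φ → HasCompactSupport φ → tsupport φ ⊆ Metric.ball ζ r →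
      (∀ z : ℂ, φ (z - 2 * ((((z - ζ) * (starRingEnd ℂ) n).re : ℝ) : ℂ) * n) = φ z) →
      (∀ z : ℂ, 0 ≤ φ z) →
      ∫ z in U, W z * (Laplacian.laplacian φ : ℂ → ℝ) z = 0

/-! ### The stubs -/

/-- **Stub 1 (interior half): layer harmonicity of `W = G (α+1) − G (α+2)` near flat pieces.**
Summit-type ("rank-2 type" in the route header): harmonicity of a difference of two bond-`ℤ²`
separating probabilities; true on site-`𝕋` by Smirnov's theorem; no `ℤ²` mechanism claimed. -/
theorem stub_layerHarmonicity : Sig.stub_layerHarmonicity := by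
  sorry

/-- **Stub 2 (boundary half, the route's lever): the derivative-free Neumann germ law** — `o(y)`
normal increments of `W` along compact pieces of the flat line (duality sum rule + lattice
reflection across the normal line + boundary two-arm germ decoupling, passed to subsequential
limits). Size XL; the unwritten input is boundary two-arm germ decoupling on `ℤ²`, uniform along
the piece. -/
theorem stub_normalIncrementGerm : Sig.stub_normalIncrementGerm := by
  sorry

/-- **Stub 3 (pure analysis, size M): weak harmonicity in the half-ball + `o(y)` normal increments
⇒ the even pairing vanishes** (Weyl, Green on shifted half-balls, Lipschitz-means argument). -/
theorem stub_incrementsToReflection : Sig.stub_incrementsToReflection := by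
  sorry

/-! ### The composition (complete proof): the three stubs give the crux BY NAME -/

/-- **`EvenReflectionLaw` from the three stubs.** Apply the layer lemma (Stub 3) to the open set
`U = T.carrier` and the continuous difference `W = G (α+1) − G (α+2)`; its weak-harmonicity input is
Stub 1 and its normal-increment input is Stub 2, both under the crux's own hypotheses. -/
theorem EvenReflectionLaw_of :
    Sig.stub_layerHarmonicity → Sig.stub_normalIncrementGerm → Sig.stub_incrementsToReflection →
      Summit.CriticalPhenomena.CardyFormulaZ2.Theses.CardyNeumannHarmonic.EvenReflectionLaw := by
  intro hL hN hA T u G hu hu0 hconv hcont α ζ n r hn hr hcarr hfront hmarks φ hφ hφc hφs hφe hφp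
  have hW : ContinuousOn (fun z => G (α + 1) z - G (α + 2) z) T.carrier :=
    (hcont (α + 1)).sub (hcont (α + 2))
  exact hA T.carrier (fun z => G (α + 1) z - G (α + 2) z) ζ n r T.isOpen hn hr hcarr hW
    (fun ψ hψ hψc hψs => hL T u G hu hu0 hconv hcont α ζ n r hn hr hcarr hfront hmarks ψ hψ hψc hψs)
    (fun K hK hKB hKS ε hε =>
      hN T u G hu hu0 hconv hcont α ζ n r hn hr hcarr hfront hmarks K hK hKB hKS ε hε)
    φ hφ hφc hφs hφe hφp

end Summit.CriticalPhenomena.CardyFormulaZ2.Cruxes.EvenReflectionLaw.Birth
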